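import Summits.HubbardSuperconductivity.HubbardSuperconductivity.Theses.ChiralWindow
import Summits.HubbardSuperconductivity.HubbardSuperconductivity.Theses.TorusCooperLog
import Literature.MathematicalPhysics.QuantumLattice.HubbardWave0LiebProofs
import Summits.HubbardSuperconductivity.HubbardSuperconductivity.Theorems.ChiralWindowCwThesisThermalPenaltyDescent
import Summits.HubbardSuperconductivity.HubbardSuperconductivity.Theorems.ChiralWindowCwThesisBlockGroundEnergy
import Summits.HubbardSuperconductivity.HubbardSuperconductivity.Theorems.ChiralWindowCwThesisPenaltyResponseLRO
import Literature.MathematicalPhysics.QuantumLattice.ApproximatingHamiltonianProofs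
import Literature.MathematicalPhysics.QuantumLattice.LiebFluxPhaseProofs
import HarnessLib

/-!
# Route `ChiralWindow`, crux `CwThesis` (stmt-HubbardSuperconductivity-10438): the penalty-line reductions

Line `SketchIdeator3` (card `Cruxes/CwThesis/Ideas/crossing-line-penalty-pointwise.md`, lead skeleton
`Cruxes/CwThesis/Lines/SketchIdeator3.lean`). This file records, sorry-free, the three ENTRY POINTS through which
the crux `ChiralWindow.CwThesis` (`∃ U₀ > 0, ∀ U ∈ (0,U₀), ∃ δ ∈ [3/10,12/25]`, the summit matrix at `(U, δ)`) is
closed by the line, so that the ONLY open content left is the weak-coupling engine: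

* `cwThesis_of_penaltyResponse` — C⁺ ⇒ X: an eventual intensive pair-penalty response
  `c·κ ≤ E_L(U;κ) - E_L(U;0)` of the sector ground ENERGIES (`E_L(U;κ) = minEnergyOn (H_L + (κ/L⁴)Δ_d†Δ_d)
  (szSector N_L 0)`, `L = 2(k+1)`) at a `U`-dependent doping `δ_U` of the window gives `CwThesis`
  (the landed `stub_penaltyResponseLRO` = `TorusCooperLog.PenaltyResponseLRO`, chord inequality + `liminf`
  bookkeeping); "every ground state" costs nothing;
* `cwThesis_of_klCanonical` — the sibling route's crux `TorusCooperLog.KLCanonical`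
  (stmt-HubbardSuperconductivity-2681: Kohn–Luttinger datum at `δ` ⇒ penalty response at `δ` for all small `U`)
  together with a certified Kohn–Luttinger `B₁g` datum at ONE doping of the window `[3/10, 12/25]` gives
  `CwThesis` with a CONSTANT `δ_U ≡ δ₀` (the card's "fallback anchor"; `∃ δ ∀ U ⇒ ∀ U ∃ δ`);
* `penaltyResponse_of_gibbsFloor` / `cwThesis_of_gibbsPenaltyFloor` — C⁺⁺ ⇒ C⁺ ⇒ X: a floor `a L⁴ ≤ Re ω(Q_p)`
  on ONE canonical Gibbs expectation of `Q = Δ_d†Δ_d` in the PENALISED `(n,n)`-block ensemble at `β = M L²`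
  (`2 log 4 ≤ M κ a`) gives the response with `c = a/2` (landed `stub_thermalPenaltyDescent`: Peierls–Bogoliubov +
  entropy sandwich; landed `stub_blockGroundEnergy`: block ground energies are the sector energies; the entropy
  price is `log|p|/(M L²) ≤ log 4/M ≤ κa/2` since `|p| ≤ 4^{L²}`), hence `CwThesis`.

All constants are quantified after `U` (Disproof.lean §6/§7: they must degenerate as `U → 0⁺`). Everything here is
folklore bookkeeping; no definition is introduced. Tasaki (2020) §2.1–2.2, App. A; Ruelle (1969) §2.5
(Peierls–Bogoliubov); Scalapino, Phys. Rep. 250 (1995) §2 eq. (2.4).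
-/

noncomputable section

namespace Summit.HubbardSuperconductivity.HubbardSuperconductivity.Theorems.CwThesis

-- `Summit.HubbardSuperconductivity.HubbardSuperconductivity.…` repeats the summit name by design (D-0017 layout)
set_option linter.dupNamespace false
-- `DecidableEq {s : Finset (Orb Λ) // …}` (the `(n,n)`-block index) exceeds the default instance size budget
set_option synthInstance.maxSize 512

open Matrix Filter Literature.MathematicalPhysics.QuantumLattice Literature.Probability.LatticeModels
open Summit.HubbardSuperconductivity.HubbardSuperconductivity.Theses
open scoped ComplexOrder

/-! ### C⁺ ⇒ X and the fallback anchor through `KLCanonical` -/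

/-- **Penalty response ⇒ the crux (C⁺ ⇒ X).** If for every weak `U` there are a doping `δ_U ∈ [3/10, 12/25]`
and `κ, c > 0` with the eventual intensive penalty response `c·κ ≤ E_L(U;κ) - E_L(U;0)` along `L = 2(k+1)`,
then `ChiralWindow.CwThesis` (by `TorusCooperLog.PenaltyResponseLRO`, landed as `stub_penaltyResponseLRO`).
[folklore] -/
theorem cwThesis_of_penaltyResponse
    (h : ∃ U₀ : ℝ, 0 < U₀ ∧ ∀ U ∈ Set.Ioo (0:ℝ) U₀, ∃ δ ∈ Set.Icc (3/10 : ℝ) (12/25),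
      ∃ κ : ℝ, 0 < κ ∧ ∃ c : ℝ, 0 < c ∧ ∀ᶠ k : ℕ in Filter.atTop,
        c * κ ≤ Matrix.minEnergyOn (hubbardTorus 2 (2 * (k + 1)) 1 U +
            ((κ / ((2 * (k + 1) : ℕ) : ℝ) ^ 4 : ℝ) : ℂ) •
              ((pairField dWaveFormFactor (2 * (k + 1)))ᴴ * pairField dWaveFormFactor (2 * (k + 1))))
            (szSector (2 * ⌊(1 - δ) * ((2 * (k + 1) : ℕ) : ℝ) ^ 2 / 2⌋₊) 0) -
          Matrix.minEnergyOn (hubbardTorus 2 (2 * (k + 1)) 1 U)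
            (szSector (2 * ⌊(1 - δ) * ((2 * (k + 1) : ℕ) : ℝ) ^ 2 / 2⌋₊) 0)) :
    ChiralWindow.CwThesis := by
  obtain ⟨U₀, hU₀, hU⟩ := h
  refine ⟨U₀, hU₀, fun U hUm => ?_⟩
  obtain ⟨δ, hδ, κ, hκ, c, hc, hev⟩ := hU U hUm
  exact ⟨δ, hδ, stub_penaltyResponseLRO U δ κ c hκ hc hev⟩

/-- **The fallback anchor: `KLCanonical` at one doping of the window ⇒ the crux.** If the sibling crux
`TorusCooperLog.KLCanonical` (stmt-HubbardSuperconductivity-2681) holds and the Kohn–Luttinger `B₁g` datum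
(attractive and strictly leading by `γU²` for all small `U`, dispersion `squareDispersion 1 0`, chemical
potential `chemicalPotentialOfDensity … (1-δ₀)`) is certified at ONE doping `δ₀ ∈ [3/10, 12/25]`, then
`ChiralWindow.CwThesis` with the constant doping `δ_U ≡ δ₀` (`[3/10,12/25] ⊂ (0,1/2)`; `∃ δ ∀ U ⇒ ∀ U ∃ δ`).
[folklore] -/
theorem cwThesis_of_klCanonical (hKL : TorusCooperLog.KLCanonical)
    (hdat : ∃ δ₀ ∈ Set.Icc (3/10 : ℝ) (12/25), ∃ γ U₁ : ℝ, 0 < γ ∧ 0 < U₁ ∧ ∀ U ∈ Set.Ioo (0:ℝ) U₁,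
      channelInf (squareDispersion 1 0) (chemicalPotentialOfDensity (squareDispersion 1 0) (1 - δ₀)) U
          D4Irrep.B1g ≤ -(γ * U ^ 2) ∧
        ∀ χ : D4Irrep, χ ≠ D4Irrep.B1g →
          channelInf (squareDispersion 1 0) (chemicalPotentialOfDensity (squareDispersion 1 0) (1 - δ₀)) U
              D4Irrep.B1g + γ * U ^ 2 ≤
            channelInf (squareDispersion 1 0) (chemicalPotentialOfDensity (squareDispersion 1 0) (1 - δ₀)) U χ) :
    ChiralWindow.CwThesis := by
  obtain ⟨δ₀, hδ₀, hdatum⟩ := hdat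
  have hδ₀' : δ₀ ∈ Set.Ioo (0:ℝ) (1 / 2) := ⟨by linarith [hδ₀.1], by linarith [hδ₀.2]⟩
  obtain ⟨U₀, hU₀, hX⟩ := hKL δ₀ hδ₀' hdatum
  refine cwThesis_of_penaltyResponse ⟨U₀, hU₀, fun U hUm => ⟨δ₀, hδ₀, ?_⟩⟩
  exact hX U hUm

/-- **The route's own crux 3 supplies the window datum, modulo attractivity.** `TorusCooperLog.KLCanonical`
(stmt-2681) and `ChiralWindow.CwKLChiralWindow` (stmt-1741: conjunct (i), `B₁g` leads every other `D₄` channel by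
`γU²` at the lower window edge `δ = a ∈ [3/10, 12/25)` for all small `U`) give `CwThesis` with `δ_U ≡ a`, PROVIDED some
non-`B₁g` channel bottom is non-positive at the dopings of the window (then leading by `γU²` forces attractivity
`Λ_{B₁g} ≤ -γU²`). The proviso is the Riemann–Lebesgue-type fact `channelInf ε μ U χ ≤ 0` for the Lindhard form in an
infinite-dimensional channel; it is taken as a hypothesis here, not proved. [folklore] -/
theorem cwThesis_of_klCanonical_of_cwKLChiralWindow (hKL : TorusCooperLog.KLCanonical)
    (hW : ChiralWindow.CwKLChiralWindow)
    (hRL : ∀ δ ∈ Set.Icc (3/10 : ℝ) (12/25), ∀ U : ℝ, 0 < U → ∃ χ : D4Irrep, χ ≠ D4Irrep.B1g ∧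
      channelInf (squareDispersion 1 0) (chemicalPotentialOfDensity (squareDispersion 1 0) (1 - δ)) U χ ≤ 0) :
    ChiralWindow.CwThesis := by
  obtain ⟨χs, -, -, a, b, γ, c, U₁, ha, hab, hb, hγ, -, hU₁, hU⟩ := hW
  have haI : a ∈ Set.Icc (3/10 : ℝ) (12/25) := ⟨ha, by linarith⟩
  refine cwThesis_of_klCanonical hKL ⟨a, haI, γ, U₁, hγ, hU₁, fun U hUm => ?_⟩
  have hU' := hU U hUm
  dsimp only at hU'
  obtain ⟨hi, -, -, -⟩ := hU'
  obtain ⟨χ, hχ, hχ0⟩ := hRL a haI U hUm.1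
  refine ⟨?_, fun χ' hχ' => hi χ' hχ'⟩
  have hle := hi χ hχ
  linarith

/-! ### Elementary counting facts -/

/-- The number of spinful occupation sets over `Λ` is `4^{|Λ|}`. [folklore] -/
theorem card_finset_orb {Λ : Type*} [LinearOrder Λ] [Fintype Λ] :
    Fintype.card (Finset (Orb Λ)) = 4 ^ Fintype.card Λ := by
  rw [Fintype.card_finset]
  have : Fintype.card (Orb Λ) = Fintype.card Λ * 2 := by simp [Orb]
  rw [this, mul_comm, pow_mul]
  norm_num

/-- The `(n,n)` occupation sector has at most `4^{|Λ|}` configurations. [folklore] -/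
theorem card_sectorConfigs_le {Λ : Type*} [LinearOrder Λ] [Fintype Λ] (n : ℕ) :
    (Fintype.card {s : Finset (Orb Λ) // (upPart s).card = n ∧ (downPart s).card = n} : ℝ) ≤
      (4 : ℝ) ^ Fintype.card Λ := by
  have h1 : Fintype.card {s : Finset (Orb Λ) // (upPart s).card = n ∧ (downPart s).card = n} ≤
      Fintype.card (Finset (Orb Λ)) := Fintype.card_subtype_le _
  rw [card_finset_orb] at h1
  exact_mod_cast h1

/-- The `(n,n)` occupation sector is nonempty when `n ≤ |Λ|`: any `n`-set `α` of sites gives the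
doubly occupied configuration `pairSet α α`. [folklore] -/
theorem nonempty_sectorConfigs {Λ : Type*} [LinearOrder Λ] [Fintype Λ] {n : ℕ}
    (hn : n ≤ Fintype.card Λ) :
    Nonempty {s : Finset (Orb Λ) // (upPart s).card = n ∧ (downPart s).card = n} := by
  obtain ⟨α, -, hα⟩ := Finset.exists_subset_card_eq (s := (Finset.univ : Finset Λ))
    (by simpa using hn)
  exact ⟨⟨pairSet α α, by rw [upPart_pairSet, hα], by rw [downPart_pairSet, hα]⟩⟩

/-- Compression is linear: `(A + c • B).toBlock p p = A.toBlock p p + c • B.toBlock p p`. [folklore] -/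
theorem toBlock_add_smul {ι : Type*} (A B : Matrix ι ι ℂ) (c : ℂ) (p : ι → Prop) :
    (A + c • B).toBlock p p = A.toBlock p p + c • B.toBlock p p := rfl

/-! ### C⁺⁺ ⇒ C⁺ ⇒ X through the landed stubs -/

/-- **One side, abstractly.** For Hermitian `H`, `Q` on the Fock space over `Λ` with `|Λ| = ℓ²`
(`ℓ > 0` real), a nonempty `(n,n)` sector, `κ, a, M > 0` with `2 log 4 ≤ M κ a`: if the Gibbs state of
the penalised block `H_p + (κ/ℓ⁴) Q_p` at `β = M ℓ²` has `a ℓ⁴ ≤ Re ω(Q_p)`, then the sector energies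
respond by at least `(a/2)·κ`: `(a/2) κ ≤ minEnergyOn (H + (κ/ℓ⁴) Q) S - minEnergyOn H S`,
`S = szSector (2n) 0`. (Engine floor × `κ/ℓ⁴`, thermal descent on the block, entropy price
`log |p| / (M ℓ²) ≤ log 4 / M ≤ κ a / 2`, block ground energies = sector energies.) [folklore] -/
theorem penaltyResponse_of_gibbsFloor (L : ℕ)
    (H Q : Matrix (Finset (Orb (FermionTorus 2 L))) (Finset (Orb (FermionTorus 2 L))) ℂ)
    (hH : H.IsHermitian) (hQ : Q.IsHermitian)
    {n : ℕ} (hn : n ≤ L ^ 2) {ℓ κ a M : ℝ} (hℓ : 0 < ℓ)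
    (hcardΛ : ((L ^ 2 : ℕ) : ℝ) = ℓ ^ 2) (hκ : 0 < κ) (hM : 0 < M)
    (hMκa : 2 * Real.log 4 ≤ M * κ * a)
    (hk : a * ℓ ^ 4 ≤ (Matrix.gibbsState (M * ℓ ^ 2)
      (H.toBlock (fun s => (upPart s).card = n ∧ (downPart s).card = n)
          (fun s => (upPart s).card = n ∧ (downPart s).card = n) +
        ((κ / ℓ ^ 4 : ℝ) : ℂ) •
          Q.toBlock (fun s => (upPart s).card = n ∧ (downPart s).card = n)
            (fun s => (upPart s).card = n ∧ (downPart s).card = n))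
      (Q.toBlock (fun s => (upPart s).card = n ∧ (downPart s).card = n)
        (fun s => (upPart s).card = n ∧ (downPart s).card = n))).re) :
    a / 2 * κ ≤ (H + ((κ / ℓ ^ 4 : ℝ) : ℂ) • Q).minEnergyOn (szSector (2 * n) 0) -
      H.minEnergyOn (szSector (2 * n) 0) := by
  -- `|FermionTorus 2 L| = L²` (as in `NoGo.card_fermionTorus_two`)
  have hcardT : Fintype.card (FermionTorus 2 L) = L ^ 2 := by simp [FermionTorus, Fintype.card_lex]
  haveI : Nonempty {s : Finset (Orb (FermionTorus 2 L)) // (upPart s).card = n ∧ (downPart s).card = n} :=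
    nonempty_sectorConfigs (hn.trans hcardT.symm.le)
  have hℓ4 : (0 : ℝ) < ℓ ^ 4 := by positivity
  have hβ : (0 : ℝ) < M * ℓ ^ 2 := by positivity
  -- hermiticity of the penalised Hamiltonian and of the blocks
  have hHQ : (H + ((κ / ℓ ^ 4 : ℝ) : ℂ) • Q).IsHermitian :=
    hH.add (IsHermitian.smul hQ (by rw [isSelfAdjoint_iff]; exact Complex.conj_ofReal _))
  have hHb : (H.toBlock (fun s => (upPart s).card = n ∧ (downPart s).card = n)
      (fun s => (upPart s).card = n ∧ (downPart s).card = n)).IsHermitian := hH.submatrix _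
  have hQb : (Q.toBlock (fun s => (upPart s).card = n ∧ (downPart s).card = n)
      (fun s => (upPart s).card = n ∧ (downPart s).card = n)).IsHermitian := hQ.submatrix _
  -- thermal descent on the block, block ground energies = sector energies
  have hdesc := stub_thermalPenaltyDescent _ _ hHb hQb hβ (κ / ℓ ^ 4)
  have hE0 := stub_blockGroundEnergy L H hH hn
  have hEκ := stub_blockGroundEnergy L _ hHQ hn
  rw [toBlock_add_smul] at hEκ
  rw [hE0, hEκ] at hdesc
  -- entropy price `log |p| / (M ℓ²) ≤ log 4 / M ≤ κ a / 2`
  have hcard := card_sectorConfigs_le (Λ := FermionTorus 2 L) n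
  rw [hcardT] at hcard
  have hcard_pos : (0 : ℝ) <
      Fintype.card {s : Finset (Orb (FermionTorus 2 L)) // (upPart s).card = n ∧ (downPart s).card = n} := by
    exact_mod_cast Fintype.card_pos
  have hlog : Real.log
      (Fintype.card {s : Finset (Orb (FermionTorus 2 L)) // (upPart s).card = n ∧ (downPart s).card = n}) ≤
      ℓ ^ 2 * Real.log 4 := by
    calc Real.log (Fintype.card {s : Finset (Orb (FermionTorus 2 L)) // (upPart s).card = n ∧ (downPart s).card = n})
        ≤ Real.log ((4 : ℝ) ^ (L ^ 2)) := Real.log_le_log hcard_pos hcard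
      _ = ℓ ^ 2 * Real.log 4 := by rw [Real.log_pow, hcardΛ]
  have hprice : Real.log
      (Fintype.card {s : Finset (Orb (FermionTorus 2 L)) // (upPart s).card = n ∧ (downPart s).card = n}) /
      (M * ℓ ^ 2) ≤ κ * a / 2 := by
    rw [div_le_iff₀ hβ]
    have hℓ2 : (0 : ℝ) < ℓ ^ 2 := by positivity
    have h4 : Real.log 4 ≤ M * κ * a / 2 := by linarith
    have h1 : ℓ ^ 2 * Real.log 4 ≤ ℓ ^ 2 * (M * κ * a / 2) := mul_le_mul_of_nonneg_left h4 hℓ2.le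
    linarith
  -- the engine's floor, scaled by `κ / ℓ⁴`
  have hfloor : κ * a ≤ κ / ℓ ^ 4 * (Matrix.gibbsState (M * ℓ ^ 2)
      (H.toBlock (fun s => (upPart s).card = n ∧ (downPart s).card = n)
          (fun s => (upPart s).card = n ∧ (downPart s).card = n) +
        ((κ / ℓ ^ 4 : ℝ) : ℂ) •
          Q.toBlock (fun s => (upPart s).card = n ∧ (downPart s).card = n)
            (fun s => (upPart s).card = n ∧ (downPart s).card = n))
      (Q.toBlock (fun s => (upPart s).card = n ∧ (downPart s).card = n)
        (fun s => (upPart s).card = n ∧ (downPart s).card = n))).re := by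
    have hκℓ : 0 < κ / ℓ ^ 4 := by positivity
    calc κ * a = κ / ℓ ^ 4 * (a * ℓ ^ 4) := by field_simp
      _ ≤ _ := mul_le_mul_of_nonneg_left hk hκℓ.le
  linarith

/-- **Thermal ascent (the converse bookkeeping, for the record).** For Hermitian `H`, `Y` on a nonempty
finite index type, `β > 0` and real `κ`: `E₀(H + κY) - E₀(H) - log |m| / β ≤ κ · Re ω_{β,H}(Y)` —
Peierls–Bogoliubov with base `H` and perturbation `κY` plus the entropy sandwich. Together with
`stub_thermalPenaltyDescent` (`κ Re ω_{β,H+κY}(Y) - log|m|/β ≤ E₀(H+κY) - E₀(H)`): up to the entropy price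
`log|m|/β` (`≤ log 4/M` on the `(n,n)` block at `β = M L²`) the `T = 0` penalty response `E₀(H+κY) - E₀(H)` is
sandwiched between `κ`× the penalty's Gibbs expectation in the PENALISED and in the UNPENALISED ensemble, so the
thermal form of the engine neither loses nor gains more than `log 4/M` against C⁺. [folklore] -/
theorem thermalPenaltyAscent {m : Type*} [Fintype m] [DecidableEq m] [Nonempty m]
    (H Y : Matrix m m ℂ) (hH : H.IsHermitian) (hY : Y.IsHermitian) {β : ℝ} (hβ : 0 < β) (κ : ℝ) :
    (H + (κ : ℂ) • Y).groundEnergy - H.groundEnergy - Real.log (Fintype.card m) / β ≤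
      κ * (Matrix.gibbsState β H Y).re := by
  have hκY : ((κ : ℂ) • Y).IsHermitian := IsHermitian.smul hY (Complex.conj_ofReal κ)
  have hK : (H + (κ : ℂ) • Y).IsHermitian := hH.add hκY
  -- Peierls–Bogoliubov with base `H`, perturbation `κ Y`
  have hPB := log_partitionFn_sub_le_log_partitionFn_add hH hκY β
  rw [map_smul, smul_eq_mul, Complex.re_ofReal_mul] at hPB
  -- entropy sandwich
  have hlow : -(β * H.groundEnergy) ≤ Real.log (partitionFn β H).re := by
    have h := Real.log_le_log (Real.exp_pos _) (exp_neg_mul_groundEnergy_le_partitionFn hH β)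
    rwa [Real.log_exp] at h
  have hcard : (0 : ℝ) < Fintype.card m := by exact_mod_cast Fintype.card_pos
  have hup : Real.log (partitionFn β (H + (κ : ℂ) • Y)).re ≤
      Real.log (Fintype.card m) - β * (H + (κ : ℂ) • Y).groundEnergy := by
    have h := Real.log_le_log (partitionFn_re_pos hK β) (partitionFn_le_card_mul_exp hK hβ.le)
    rwa [Real.log_mul hcard.ne' (Real.exp_pos _).ne', Real.log_exp] at h
  have key : β * ((H + (κ : ℂ) • Y).groundEnergy - H.groundEnergy) - Real.log (Fintype.card m) ≤
      β * (κ * (Matrix.gibbsState β H Y).re) := by linarith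
  have key' : (H + (κ : ℂ) • Y).groundEnergy - H.groundEnergy - κ * (Matrix.gibbsState β H Y).re ≤
      Real.log (Fintype.card m) / β := by
    rw [le_div_iff₀ hβ]
    linarith
  linarith

/-- **Canonical Gibbs floor ⇒ the crux (C⁺⁺ ⇒ X).** If for every weak `U` there are a doping
`δ_U ∈ [3/10, 12/25]` and `κ, a, M > 0` with `2 log 4 ≤ M κ a` such that, eventually along `L = 2(k+1)`, the
canonical Gibbs state of the penalised `(n,n)`-block Hamiltonian `H_p + (κ/L⁴) Q_p` (`2n = N_L(δ_U)`,
`H = hubbardTorus 2 L 1 U`, `Q = Δ_d†Δ_d`) at `β = M L²` has `a L⁴ ≤ Re ω(Q_p)`, then `ChiralWindow.CwThesis`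
(`penaltyResponse_of_gibbsFloor` at `ℓ = L`, `c = a/2`, then `cwThesis_of_penaltyResponse`). This is the
skeleton theorem `CwThesis_of` of the line with its engine stub `stub_gibbsPenaltyFloor` as hypothesis.
(The statement is kept on one line: it is the registered stub signature, matched textually by the gate.)
[folklore] -/
theorem cwThesis_of_gibbsPenaltyFloor : (∃ U₀ : ℝ, 0 < U₀ ∧ ∀ U ∈ Set.Ioo (0:ℝ) U₀, ∃ δ ∈ Set.Icc (3/10 : ℝ) (12/25), ∃ κ a M : ℝ, 0 < κ ∧ 0 < a ∧ 0 < M ∧ 2 * Real.log 4 ≤ M * κ * a ∧ ∀ᶠ k : ℕ in atTop, let L : ℕ := 2 * (k + 1); let n : ℕ := ⌊(1 - δ) * (L : ℝ) ^ 2 / 2⌋₊; let Hp := (hubbardTorus 2 L 1 U).toBlock (fun s => (upPart s).card = n ∧ (downPart s).card = n) (fun s => (upPart s).card = n ∧ (downPart s).card = n); let Qp := ((pairField dWaveFormFactor L)ᴴ * pairField dWaveFormFactor L).toBlock (fun s => (upPart s).card = n ∧ (downPart s).card = n) (fun s => (upPart s).card = n ∧ (downPart s).card = n); a * (L : ℝ)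 ^ 4 ≤ (Matrix.gibbsState (M * (L : ℝ) ^ 2) (Hp + ((κ / (L : ℝ) ^ 4 : ℝ) : ℂ) • Qp) Qp).re) → ChiralWindow.CwThesis := by
  rintro ⟨U₀, hU₀, hU⟩
  refine cwThesis_of_penaltyResponse ⟨U₀, hU₀, fun U hUm => ?_⟩
  obtain ⟨δ, hδ, κ, a, M, hκ, ha, hM, hMκa, hev⟩ := hU U hUm
  refine ⟨δ, hδ, κ, hκ, a / 2, by positivity, ?_⟩
  filter_upwards [hev] with k hk
  dsimp only at hk
  have hδ0 : (0 : ℝ) ≤ δ := by linarith [hδ.1]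
  have hLpos : (0 : ℝ) < ((2 * (k + 1) : ℕ) : ℝ) := by positivity
  -- `⌊(1-δ)L²/2⌋ ≤ L²` for `δ ≥ 0` (as in `WcbcsSsbToTorusLRO.Negative.halfFilling_floor_le_sq`)
  have hn : ⌊(1 - δ) * (((2 * (k + 1) : ℕ)) : ℝ) ^ 2 / 2⌋₊ ≤ (2 * (k + 1)) ^ 2 := by
    have hx : (1 - δ) * (((2 * (k + 1) : ℕ)) : ℝ) ^ 2 / 2 ≤ (((2 * (k + 1)) ^ 2 : ℕ) : ℝ) := by
      push_cast
      nlinarith [sq_nonneg (((2 * (k + 1) : ℕ)) : ℝ)]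
    exact (Nat.floor_mono hx).trans (Nat.floor_natCast _).le
  have hcardΛ : (((2 * (k + 1)) ^ 2 : ℕ) : ℝ) = (((2 * (k + 1) : ℕ)) : ℝ) ^ 2 := by
    push_cast; ring
  exact penaltyResponse_of_gibbsFloor (2 * (k + 1)) (hubbardTorus 2 (2 * (k + 1)) 1 U)
    ((pairField dWaveFormFactor (2 * (k + 1)))ᴴ * pairField dWaveFormFactor (2 * (k + 1)))
    (hubbardTorus_isHermitian (hamiltonian_isHermitian_and_commute_holds _) 1 U)
    (isHermitian_conjTranspose_mul_self _) hn hLpos hcardΛ hκ hM hMκa hk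

end Summit.HubbardSuperconductivity.HubbardSuperconductivity.Theorems.CwThesis

end
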